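import Mathlib
import HarnessLib
import Summits.HubbardSuperconductivity.HubbardSuperconductivity.Theses.ChiralWindow
import Summits.HubbardSuperconductivity.HubbardSuperconductivity.Theorems.ChiralWindowCwKLChiralWindowReductionHS
import Summits.HubbardSuperconductivity.HubbardSuperconductivity.Theorems.ChiralWindowCwKLChiralWindowLindhardD4
import Summits.HubbardSuperconductivity.HubbardSuperconductivity.Theorems.ChiralWindowCwKLChiralWindowRotPartner
import Summits.HubbardSuperconductivity.HubbardSuperconductivity.Theorems.ChiralWindowCwKLChiralWindowKernelOp
import Summits.HubbardSuperconductivity.HubbardSuperconductivity.Theorems.ChiralWindowCwKLChiralWindowD4Unitary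
import Summits.HubbardSuperconductivity.HubbardSuperconductivity.Theorems.ChiralWindowCwKLChiralWindowSectorProj
import Summits.HubbardSuperconductivity.HubbardSuperconductivity.Theorems.ChiralWindowCwKLChiralWindowBottomStates
import Summits.HubbardSuperconductivity.HubbardSuperconductivity.Theorems.ChiralWindowCwKLChiralWindowWindowBridge
import Summits.HubbardSuperconductivity.HubbardSuperconductivity.Theorems.ChiralWindowCwKLChiralWindowKernelHS
import Summits.HubbardSuperconductivity.HubbardSuperconductivity.Theorems.ChiralWindowCwKLChiralWindowChannelOps
import Summits.HubbardSuperconductivity.HubbardSuperconductivity.Theorems.ChiralWindowCwKLChiralWindowCertNumericalR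
import Summits.HubbardSuperconductivity.HubbardSuperconductivity.Theorems.ChiralWindowCwKLChiralWindowKlCert

/-!
# Crux `CwKLChiralWindow` (stmt-1741), line `Sketch`: the crux from an accepted, certified record — RESIDUAL FORM

`cwKLChiralWindow_of_klCertR : ∀ c : KLCert, c.checkR = true → c.EnclosuresR → CwKLChiralWindow` — the END of the Lean side of
the certificate: given ANY rational record accepted by the kernel-decidable checker `KLCert.checkR`
(`Theorems/ChiralWindowDefsResidual.lean`) whose enclosures E0, E1, E2, E3R, E4–E6 hold (`KLCert.EnclosuresR`, the named numerical hypothesis certified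
by interval arithmetic, `Cruxes/CwKLChiralWindow/CertInterface.md`), the crux follows: soundness `stub_klCertNumericalR` gives the `μ`-form clauses N0–N5 on `[c.mub, c.mua]`; the window bridge `a = 1 - n(μ_a)`, `b = 1 - n(μ_b)`
(`stub_klWindowBridge`), bottom states from the landed operator package (`stub_klKernelOp`, `stub_klD4Unitary`,
`stub_klSectorProj`, `stub_klBottomStates`), the rotate of the `E` state (`stub_klRotPartner`) and
`cwKLChiralWindow_of_certificateHS` (p103087) assemble `CwKLChiralWindow` with witness `χs = E`, `γ = c.gamma`, `c = c.cov`,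
`U₁ = 1`.  What remains for the crux is the computation: a concrete record `klCert` with `klCert.checkR = true` (by `decide`)
and `klCert.EnclosuresR` (certified enclosures, `ccert` seat).  The composition helpers `klc6_*` are reused from the α-form file.
-/

noncomputable section

set_option linter.dupNamespace false

namespace Summit.HubbardSuperconductivity.HubbardSuperconductivity.Theorems

open MeasureTheory Literature.MathematicalPhysics.QuantumLattice CwKLChiralWindow
open Summit.HubbardSuperconductivity.HubbardSuperconductivity.Theses.ChiralWindow

/-- **The crux from an accepted record with certified enclosures** (`cwKLChiralWindow_of_klCertR`): witness `χs = E`,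
`a = 1 - n(c.mua)`, `b = 1 - n(c.mub)`, `γ = c.gamma`, `c = c.cov`, `U₁ = 1`. [folklore] -/
theorem cwKLChiralWindow_of_klCertR : ∀ c : KLCert, c.checkR = true → c.EnclosuresR → CwKLChiralWindow := by
  intro c hc hE
  obtain ⟨⟨h4, hba, ha0, hγ, hcov0⟩, hN0a, hN0b, hN1, hN2, hN3, hN4, hN5⟩ := stub_klCertNumericalR c hc hE
  obtain ⟨hab, hμa, hμb, hwin⟩ := stub_klWindowBridge ((c.mua : ℚ) : ℝ) ((c.mub : ℚ) : ℝ) h4 hba ha0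
  refine cwKLChiralWindow_of_certificateHS ⟨D4Irrep.E, by decide, by decide, by decide,
    1 - KohnLuttinger.filling (squareDispersion 1 0) ((c.mua : ℚ) : ℝ),
    1 - KohnLuttinger.filling (squareDispersion 1 0) ((c.mub : ℚ) : ℝ),
    ((c.gamma : ℚ) : ℝ), ((c.cov : ℚ) : ℝ), hN0a, hab, hN0b, hγ, hcov0, ?_, ?_, ?_, ?_⟩
  · intro χ hχ
    rw [hμa]
    exact hN1 χ hχ
  · intro χ hχ
    rw [hμb]
    exact hN2 χ hχ
  · intro δ hδ χ h1 h2
    exact hN3 _ (hwin δ hδ).1 χ h1 h2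
  · intro δ hδ
    obtain ⟨hμδ, -⟩ := hwin δ hδ
    have hμ' : chemicalPotentialOfDensity (squareDispersion 1 0) (1 - δ) ∈ Set.Ioo (-4 : ℝ) 0 :=
      ⟨by linarith [hμδ.1], by linarith [hμδ.2]⟩
    exact klc6_nodeCover_at hμ' (hN4 _ hμδ).1 (hN4 _ hμδ).2 (hN5 _ hμδ)

end Summit.HubbardSuperconductivity.HubbardSuperconductivity.Theorems

end
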